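import Summits.KontsevichZagierPeriods.KontsevichZagierPeriods.Theses.HermiteRigidity
import Summits.KontsevichZagierPeriods.KontsevichZagierPeriods.Theorems.HermiteRigidityRealEllipticSectorKernelStubExactForm
import Summits.KontsevichZagierPeriods.KontsevichZagierPeriods.Theorems.HermiteRigidityRealEllipticSectorKernelStubRoots
import Summits.KontsevichZagierPeriods.KontsevichZagierPeriods.Theorems.HermiteRigidityRealEllipticSectorKernelStubTwoTorsion
import Summits.KontsevichZagierPeriods.KontsevichZagierPeriods.Theorems.HermiteRigidityRealEllipticSectorKernelStubReduction
import Summits.KontsevichZagierPeriods.KontsevichZagierPeriods.Theorems.RealEllipticSectorKernel.Negative.Core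
import Summits.KontsevichZagierPeriods.KontsevichZagierPeriods.Theorems.RealEllipticSectorKernel.Negative.Ovals
import Summits.KontsevichZagierPeriods.KontsevichZagierPeriods.Theorems.ReducedPeriodRing.Negative.Certificates
import Literature.NumberTheory.Transcendental.KZRelationsLE
import Literature.NumberTheory.Transcendental.KZLogCalculusProofs
import Literature.NumberTheory.Transcendental.KZSubcalculusInvariants
import Literature.NumberTheory.Transcendental.KZSemialgebraicComplex
import Literature.NumberTheory.Transcendental.SemialgebraicMapsProofs

/-!
# `RealEllipticSectorKernel` (stmt-KontsevichZagierPeriods-10632) — proof, line `oval-hermite-engine`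

Crux `HermiteRigidity.RealEllipticSectorKernel`: for a rational Weierstrass cubic `f = 4x³ − q₂x − q₃`
with `Δ > 0`, IF `1, J₀, J₁, K₀, K₁` are linearly independent over the real algebraic numbers THEN
every `ℤ`-combination of the sector generators `[σ, xᵐ/√f]`, `[σ', xᵐ/√(−f)]`, `[σ'', 1/√f]` of
value `0` lies in `KZ.relations`.

Line (card `oval-hermite-engine`): ONE Hermite exact-form move `[(u,v), (Q'g + Qg'/2)/√g] ∈ relations`
for a general rational `g` on an oval `(u,v)` (`g(u) = g(v) = 0`, `g > 0` inside) — instantiated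
with `g = f` on `σ = (e₃,e₂)` and `g = −f` on `σ' = (e₂,e₁)`; Hermite's decomposition
`ℚ[X] = ℚ[X]_{<2} + D_g ℚ[X]` (pure algebra); one rule-2 move for `σ''` (translation by the
2-torsion point `(e₂,0)`); integer normal form `N•c ≡ Σ nᵢ[bᵢ]` on the four basis representations
and integer division (the formal period group is uniquely divisible).

The four move-level / algebraic inputs are the landed stub files of the line (imported):
`stub_roots` (roots and the typed ovals as intervals), `stub_exactForm` (the Hermite rule-3 move),
`stub_twoTorsion` (the rule-2 move for `σ''`), `stub_reduction` (integer normal form of a moment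
generator). This file supplies the glue (semialgebraicity of the typed ovals, the four basis
representations — integrable because the rigidity hypothesis forces `J₀, J₁, K₀, K₁ ≠ 0` —, closure
induction on integer normal forms, ℚ-rigidity ⇒ zero coefficients, integer division) and the
composition `RealEllipticSectorKernel_of`, then `RealEllipticSectorKernel_proof`.

Sources: M. Kontsevich, D. Zagier, *Periods* (2001), §§1.1–1.2; A. Bostan, P. Lairez, B. Salvy,
ISSAC 2013 (Hermite reduction); D. Masser, *Elliptic Functions and Transcendence*, LNM 437 (1975),
Ch. II (the rigidity hypothesis, consumed as given).
-/

noncomputable section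

open MeasureTheory Set Polynomial

namespace Summit.KontsevichZagierPeriods.HermiteRigidity.RealEllipticSectorKernel

open Literature.NumberTheory.Transcendental Literature.ModelTheory.ExponentialFields
open Summit.KontsevichZagierPeriods.RealEllipticSectorKernel.Negative
open Summit.KontsevichZagierPeriods.RealEllipticSectorKernel.Ovals
open Summit.KontsevichZagierPeriods.KontsevichZagierPeriods.Theses.HermiteRigidity (RealEllipticSectorKernel)

/-! ## Glue: the polynomial, semialgebraicity, basis representations -/

/-- The Weierstrass cubic is the evaluation of `4X³ − q₂X − q₃ ∈ ℚ[X]`. [folklore] -/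
theorem glue_aeval_cubicPoly (q₂ q₃ : ℚ) (x : ℝ) :
    aeval x (4 * X ^ 3 - C q₂ * X - C q₃ : ℚ[X]) = cubic q₂ q₃ x := by
  simp only [map_sub, map_mul, map_pow, aeval_X, aeval_C, eq_ratCast, map_ofNat, cubic]

/-- … and of its negative. [folklore] -/
theorem glue_aeval_neg_cubicPoly (q₂ q₃ : ℚ) (x : ℝ) :
    aeval x (-(4 * X ^ 3 - C q₂ * X - C q₃) : ℚ[X]) = - cubic q₂ q₃ x := by
  rw [map_neg, glue_aeval_cubicPoly]

/-- `4X³ − q₂X − q₃` has degree `3`. [folklore] -/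
theorem glue_natDegree_cubicPoly (q₂ q₃ : ℚ) :
    (4 * X ^ 3 - C q₂ * X - C q₃ : ℚ[X]).natDegree = 3 := by
  have h4 : (C 4 : ℚ[X]) = 4 := map_ofNat C 4
  have h : (4 * X ^ 3 - C q₂ * X - C q₃ : ℚ[X]) = C 4 * X ^ 3 + C 0 * X ^ 2 + C (-q₂) * X + C (-q₃) := by
    rw [h4]
    simp only [map_zero, zero_mul, add_zero, map_neg, neg_mul]
    ring
  rw [h]
  exact natDegree_cubic (by norm_num)

/-- `−(4X³ − q₂X − q₃)` has degree `3`. [folklore] -/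
theorem glue_natDegree_neg_cubicPoly (q₂ q₃ : ℚ) :
    (-(4 * X ^ 3 - C q₂ * X - C q₃) : ℚ[X]).natDegree = 3 := by
  rw [natDegree_neg, glue_natDegree_cubicPoly]

/-- Multiplying a `ℚ`-semialgebraic function on a subset of `ℝ¹` by the coordinate keeps it
`ℚ`-semialgebraic. [folklore] -/
theorem isSemialgebraicFunOn_coord_mul {D : Set (Fin 1 → ℝ)} {φ : (Fin 1 → ℝ) → ℝ}
    (hφ : IsSemialgebraicFunOn ℚ D φ) :
    IsSemialgebraicFunOn ℚ D (fun p => p 0 * φ p) := by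
  have hD : IsSemialgebraic ℚ D := IsSemialgebraicFunOn.isSemialgebraic_holds hφ
  have hX : IsSemialgebraicFunOn ℚ D (fun p => p 0) :=
    (isSemialgebraicFunOn_aeval hD (MvPolynomial.X 0)).congr fun p _ => by simp
  exact (IsSemialgebraicFunOn.mul_holds hX hφ).congr fun p _ => by simp

/-- A representation with prescribed domain and integrand exists as soon as the three side
conditions hold (packaging). [folklore] -/
theorem exists_rep {D : Set (Fin 1 → ℝ)} {φ : (Fin 1 → ℝ) → ℝ} (hD : IsSemialgebraic ℚ D)
    (hφ : IsSemialgebraicFunOn ℚ D φ) (hint : IntegrableOn φ D) :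
    ∃ b : KZ.IntegralRep 1, b.domain = D ∧ b.integrand = φ :=
  ⟨⟨D, φ, hD, hφ, hint⟩, rfl, rfl⟩

/-- A set integral which is non-zero is the integral of an integrable function (Bochner's junk value
is `0`). [folklore] -/
theorem integrableOn_of_integral_ne_zero {D : Set (Fin 1 → ℝ)} {φ : (Fin 1 → ℝ) → ℝ}
    (h : (∫ p in D, φ p) ≠ 0) : IntegrableOn φ D := by
  by_contra hn
  exact h (integral_undef hn)

/-- The rigidity hypothesis makes the four basic integrals non-zero, hence their integrands
integrable (slots `b, c, d, e = 1`). [folklore] -/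
theorem basis_integrable {q₂ q₃ : ℚ} (h : Rigidity q₂ q₃) :
    IntegrableOn (fun p : Fin 1 → ℝ => 1 / Real.sqrt (cubic q₂ q₃ (p 0))) (σ₁ q₂ q₃) ∧
    IntegrableOn (fun p : Fin 1 → ℝ => p 0 / Real.sqrt (cubic q₂ q₃ (p 0))) (σ₁ q₂ q₃) ∧
    IntegrableOn (fun p : Fin 1 → ℝ => 1 / Real.sqrt (-cubic q₂ q₃ (p 0))) (σ₂ q₂ q₃) ∧
    IntegrableOn (fun p : Fin 1 → ℝ => p 0 / Real.sqrt (-cubic q₂ q₃ (p 0))) (σ₂ q₂ q₃) := by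
  refine ⟨integrableOn_of_integral_ne_zero fun h0 => ?_, integrableOn_of_integral_ne_zero fun h0 => ?_,
    integrableOn_of_integral_ne_zero fun h0 => ?_, integrableOn_of_integral_ne_zero fun h0 => ?_⟩
  · have := h 0 1 0 0 0 isAlgebraic_zero isAlgebraic_one isAlgebraic_zero isAlgebraic_zero
      isAlgebraic_zero (by rw [show J₀ q₂ q₃ = 0 from h0]; ring)
    exact one_ne_zero this.2.1
  · have := h 0 0 1 0 0 isAlgebraic_zero isAlgebraic_zero isAlgebraic_one isAlgebraic_zero
      isAlgebraic_zero (by rw [show J₁ q₂ q₃ = 0 from h0]; ring)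
    exact one_ne_zero this.2.2.1
  · have := h 0 0 0 1 0 isAlgebraic_zero isAlgebraic_zero isAlgebraic_zero isAlgebraic_one
      isAlgebraic_zero (by rw [show K₀ q₂ q₃ = 0 from h0]; ring)
    exact one_ne_zero this.2.2.2.1
  · have := h 0 0 0 0 1 isAlgebraic_zero isAlgebraic_zero isAlgebraic_zero isAlgebraic_zero
      isAlgebraic_one (by rw [show K₁ q₂ q₃ = 0 from h0]; ring)
    exact one_ne_zero this.2.2.2.2

/-- **The four basis representations exist**: `b₀ = [σ, 1/√f]`, `b₁ = [σ, x/√f]`,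
`b₂ = [σ', 1/√(−f)]`, `b₃ = [σ', x/√(−f)]`, with integrands literally those of `J₀, J₁, K₀, K₁`.
[folklore] -/
theorem exists_basis {q₂ q₃ : ℚ} (h : Rigidity q₂ q₃) :
    ∃ b₀ b₁ b₂ b₃ : KZ.IntegralRep 1,
      (b₀.domain = σ₁ q₂ q₃ ∧ b₀.integrand = fun p => 1 / Real.sqrt (cubic q₂ q₃ (p 0))) ∧
      (b₁.domain = σ₁ q₂ q₃ ∧ b₁.integrand = fun p => p 0 / Real.sqrt (cubic q₂ q₃ (p 0))) ∧
      (b₂.domain = σ₂ q₂ q₃ ∧ b₂.integrand = fun p => 1 / Real.sqrt (-cubic q₂ q₃ (p 0))) ∧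
      (b₃.domain = σ₂ q₂ q₃ ∧ b₃.integrand = fun p => p 0 / Real.sqrt (-cubic q₂ q₃ (p 0))) := by
  obtain ⟨i₀, i₁, i₂, i₃⟩ := basis_integrable h
  have s₀ := isSemialgebraicFunOn_inv_sqrt_cubic q₂ q₃
  have s₂ := isSemialgebraicFunOn_inv_sqrt_neg_cubic q₂ q₃
  have s₁ : IsSemialgebraicFunOn ℚ (σ₁ q₂ q₃) (fun p => p 0 / Real.sqrt (cubic q₂ q₃ (p 0))) :=
    (isSemialgebraicFunOn_coord_mul s₀).congr fun p _ => (div_eq_mul_one_div _ _).symm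
  have s₃ : IsSemialgebraicFunOn ℚ (σ₂ q₂ q₃) (fun p => p 0 / Real.sqrt (-cubic q₂ q₃ (p 0))) :=
    (isSemialgebraicFunOn_coord_mul s₂).congr fun p _ => (div_eq_mul_one_div _ _).symm
  obtain ⟨b₀, hb₀⟩ := exists_rep (isSemialgebraic_σ₁ q₂ q₃) s₀ i₀
  obtain ⟨b₁, hb₁⟩ := exists_rep (isSemialgebraic_σ₁ q₂ q₃) s₁ i₁
  obtain ⟨b₂, hb₂⟩ := exists_rep (isSemialgebraic_σ₂ q₂ q₃) s₂ i₂
  obtain ⟨b₃, hb₃⟩ := exists_rep (isSemialgebraic_σ₂ q₂ q₃) s₃ i₃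
  exact ⟨b₀, b₁, b₂, b₃, hb₀, hb₁, hb₂, hb₃⟩

/-! ## Glue: integer normal forms -/

/-- Integer division is a derived rule of the calculus: the formal period group
`FormalRep ⧸ relations` is uniquely divisible (`ReducedPeriodRingNegative.nsmul_bijective`).
[folklore] -/
theorem integerDivision (c : KZ.FormalRep) {N : ℕ} (hN : 0 < N) (h : N • c ∈ KZ.relations) :
    c ∈ KZ.relations := by
  rw [← KZ.toFormalPeriod_eq_zero_iff] at h ⊢
  rw [map_nsmul] at h
  have hinj :=
    (Summit.KontsevichZagierPeriods.KontsevichZagierPeriods.ReducedPeriodRingNegative.nsmul_bijective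
      hN).1
  exact hinj (show N • KZ.toFormalPeriod c = N • (0 : KZ.FormalPeriodRing) by rw [smul_zero]; exact h)

/-- The integer normal form predicate on four basis elements. (Local to the proof; a `Prop`-valued
abbreviation spelled out at each use.) Closure under addition. [folklore] -/
theorem nf_add {B₀ B₁ B₂ B₃ x y : KZ.FormalRep}
    (hx : ∃ (N : ℕ) (a₀ a₁ a₂ a₃ : ℤ), 0 < N ∧
      N • x - (a₀ • B₀ + a₁ • B₁ + a₂ • B₂ + a₃ • B₃) ∈ KZ.relations)
    (hy : ∃ (N : ℕ) (a₀ a₁ a₂ a₃ : ℤ), 0 < N ∧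
      N • y - (a₀ • B₀ + a₁ • B₁ + a₂ • B₂ + a₃ • B₃) ∈ KZ.relations) :
    ∃ (N : ℕ) (a₀ a₁ a₂ a₃ : ℤ), 0 < N ∧
      N • (x + y) - (a₀ • B₀ + a₁ • B₁ + a₂ • B₂ + a₃ • B₃) ∈ KZ.relations := by
  obtain ⟨N, a₀, a₁, a₂, a₃, hN, hx⟩ := hx
  obtain ⟨M, c₀, c₁, c₂, c₃, hM, hy⟩ := hy
  refine ⟨N * M, M * a₀ + N * c₀, M * a₁ + N * c₁, M * a₂ + N * c₂, M * a₃ + N * c₃,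
    Nat.mul_pos hN hM, ?_⟩
  have key : (N * M) • (x + y) - ((M * a₀ + N * c₀) • B₀ + (M * a₁ + N * c₁) • B₁ +
      (M * a₂ + N * c₂) • B₂ + (M * a₃ + N * c₃) • B₃)
      = (M : ℤ) • (N • x - (a₀ • B₀ + a₁ • B₁ + a₂ • B₂ + a₃ • B₃))
        + (N : ℤ) • (M • y - (c₀ • B₀ + c₁ • B₁ + c₂ • B₂ + c₃ • B₃)) := by
    module
  rw [key]
  exact add_mem (AddSubgroup.zsmul_mem _ hx _) (AddSubgroup.zsmul_mem _ hy _)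

/-- Closure under negation. [folklore] -/
theorem nf_neg {B₀ B₁ B₂ B₃ x : KZ.FormalRep}
    (hx : ∃ (N : ℕ) (a₀ a₁ a₂ a₃ : ℤ), 0 < N ∧
      N • x - (a₀ • B₀ + a₁ • B₁ + a₂ • B₂ + a₃ • B₃) ∈ KZ.relations) :
    ∃ (N : ℕ) (a₀ a₁ a₂ a₃ : ℤ), 0 < N ∧
      N • (-x) - (a₀ • B₀ + a₁ • B₁ + a₂ • B₂ + a₃ • B₃) ∈ KZ.relations := by
  obtain ⟨N, a₀, a₁, a₂, a₃, hN, hx⟩ := hx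
  refine ⟨N, -a₀, -a₁, -a₂, -a₃, hN, ?_⟩
  have key : N • (-x) - ((-a₀) • B₀ + (-a₁) • B₁ + (-a₂) • B₂ + (-a₃) • B₃)
      = -(N • x - (a₀ • B₀ + a₁ • B₁ + a₂ • B₂ + a₃ • B₃)) := by
    module
  rw [key]
  exact neg_mem hx

/-- **Kernel step**: an element in integer normal form whose value vanishes is a relation, provided
the four basis values are `ℚ`-linearly independent (soundness of the moves, then integer division).
[folklore] -/
theorem mem_relations_of_nf {b₀ b₁ b₂ b₃ : KZ.IntegralRep 1}
    (hind : ∀ a₀ a₁ a₂ a₃ : ℚ, (a₀ : ℝ) * b₀.value + a₁ * b₁.value + a₂ * b₂.value + a₃ * b₃.value = 0 →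
      a₀ = 0 ∧ a₁ = 0 ∧ a₂ = 0 ∧ a₃ = 0)
    {c : KZ.FormalRep} (hc0 : KZ.eval c = 0)
    (hc : ∃ (N : ℕ) (a₀ a₁ a₂ a₃ : ℤ), 0 < N ∧
      N • c - (a₀ • KZ.of b₀ + a₁ • KZ.of b₁ + a₂ • KZ.of b₂ + a₃ • KZ.of b₃) ∈ KZ.relations) :
    c ∈ KZ.relations := by
  obtain ⟨N, a₀, a₁, a₂, a₃, hN, hnf⟩ := hc
  have hsound : KZ.eval (N • c - (a₀ • KZ.of b₀ + a₁ • KZ.of b₁ + a₂ • KZ.of b₂ + a₃ • KZ.of b₃)) = 0 :=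
    (AddMonoidHom.mem_ker).1 (KZ.relations_le_ker_eval_holds hnf)
  have hlin : (a₀ : ℝ) * b₀.value + a₁ * b₁.value + a₂ * b₂.value + a₃ * b₃.value = 0 := by
    simp only [map_sub, map_nsmul, map_add, map_zsmul, hc0, smul_zero, zero_sub, neg_eq_zero,
      zsmul_eq_mul, KZ.eval_of] at hsound
    linarith
  obtain ⟨r0, r1, r2, r3⟩ := hind a₀ a₁ a₂ a₃ (by push_cast; exact hlin)
  have e0 : a₀ = 0 := by exact_mod_cast r0
  have e1 : a₁ = 0 := by exact_mod_cast r1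
  have e2 : a₂ = 0 := by exact_mod_cast r2
  have e3 : a₃ = 0 := by exact_mod_cast r3
  subst e0 e1 e2 e3
  simp only [zero_smul, add_zero, sub_zero] at hnf
  exact integerDivision c hN hnf

/-! ## Composition -/

/-- **The line closes the crux**: roots + exact form + two-torsion + reduction ⇒
`RealEllipticSectorKernel`. Every generator is put in integer normal form on the four basis
representations (`σ`: reduction with `g = f` on `(e₃,e₂)`; `σ'`: reduction with `g = −f` on
`(e₂,e₁)`; `σ''`: the two-torsion move onto `b₀`), normal forms are closed under the group
operations, and a normal form of value `0` is a relation by ℚ-rigidity of `(J₀,J₁,K₀,K₁)` and integer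
division. [folklore] -/
theorem RealEllipticSectorKernel_of
    (hroots : ∀ (q₂ q₃ : ℚ), 0 < discr q₂ q₃ →
      ∃ e₁ e₂ e₃ : ℝ, e₃ < e₂ ∧ e₂ < e₁ ∧ IsAlgebraic ℚ e₁ ∧ IsAlgebraic ℚ e₂ ∧ IsAlgebraic ℚ e₃ ∧
        (∀ x, cubic q₂ q₃ x = 4 * (x - e₁) * (x - e₂) * (x - e₃)) ∧
        σ₁ q₂ q₃ = {p | e₃ < p 0 ∧ p 0 < e₂} ∧
        σ₂ q₂ q₃ = {p | e₂ < p 0 ∧ p 0 < e₁} ∧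
        σ₃ q₂ q₃ = {p | e₁ < p 0})
    (hexact : ∀ (g Q : ℚ[X]) (u v : ℝ), u < v → aeval u g = 0 → aeval v g = 0 →
      (∀ x ∈ Ioo u v, 0 < aeval x g) →
      ∀ (r : KZ.IntegralRep 1), r.domain = {p | u < p 0 ∧ p 0 < v} →
        EqOn r.integrand (fun p => (aeval (p 0) (derivative Q) * aeval (p 0) g
          + aeval (p 0) Q * aeval (p 0) (derivative g) / 2) / Real.sqrt (aeval (p 0) g)) r.domain →
        KZ.of r ∈ KZ.relations)
    (htors : ∀ (q₂ q₃ : ℚ) (e₁ e₂ e₃ : ℝ), e₃ < e₂ → e₂ < e₁ →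
      IsAlgebraic ℚ e₁ → IsAlgebraic ℚ e₂ → IsAlgebraic ℚ e₃ →
      (∀ x, cubic q₂ q₃ x = 4 * (x - e₁) * (x - e₂) * (x - e₃)) →
      ∀ (r'' r : KZ.IntegralRep 1), r''.domain = {p | e₁ < p 0} →
        EqOn r''.integrand (fun p => 1 / Real.sqrt (cubic q₂ q₃ (p 0))) r''.domain →
        r.domain = {p | e₃ < p 0 ∧ p 0 < e₂} →
        EqOn r.integrand (fun p => 1 / Real.sqrt (cubic q₂ q₃ (p 0))) r.domain →
        KZ.of r'' - KZ.of r ∈ KZ.relations)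
    (hred : ∀ (g : ℚ[X]), g.natDegree = 3 → ∀ (u v : ℝ),
      (∀ (Q : ℚ[X]) (s : KZ.IntegralRep 1), s.domain = {p | u < p 0 ∧ p 0 < v} →
        EqOn s.integrand (fun p => (aeval (p 0) (derivative Q) * aeval (p 0) g
          + aeval (p 0) Q * aeval (p 0) (derivative g) / 2) / Real.sqrt (aeval (p 0) g)) s.domain →
        KZ.of s ∈ KZ.relations) →
      ∀ (b₀ b₁ r : KZ.IntegralRep 1) (m : ℕ),
        b₀.domain = {p | u < p 0 ∧ p 0 < v} →
        EqOn b₀.integrand (fun p => 1 / Real.sqrt (aeval (p 0) g)) b₀.domain →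
        b₁.domain = {p | u < p 0 ∧ p 0 < v} →
        EqOn b₁.integrand (fun p => p 0 / Real.sqrt (aeval (p 0) g)) b₁.domain →
        r.domain = {p | u < p 0 ∧ p 0 < v} →
        EqOn r.integrand (fun p => p 0 ^ m / Real.sqrt (aeval (p 0) g)) r.domain →
        ∃ (N : ℕ) (a b : ℤ), 0 < N ∧ N • KZ.of r - (a • KZ.of b₀ + b • KZ.of b₁) ∈ KZ.relations) :
    RealEllipticSectorKernel := by
  refine crux_iff.mpr fun q₂ q₃ hΔ hrig => ?_
  -- roots and intervals
  obtain ⟨e₁, e₂, e₃, h32, h21, ha₁, ha₂, ha₃, hf, hσ₁, hσ₂, hσ₃⟩ := hroots q₂ q₃ hΔ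
  -- the two polynomials
  set g₁ : ℚ[X] := 4 * X ^ 3 - C q₂ * X - C q₃ with hg₁
  set g₂ : ℚ[X] := -(4 * X ^ 3 - C q₂ * X - C q₃) with hg₂
  have hag₁ : ∀ x : ℝ, aeval x g₁ = cubic q₂ q₃ x := glue_aeval_cubicPoly q₂ q₃
  have hag₂ : ∀ x : ℝ, aeval x g₂ = - cubic q₂ q₃ x := glue_aeval_neg_cubicPoly q₂ q₃
  have hdeg₁ : g₁.natDegree = 3 := glue_natDegree_cubicPoly q₂ q₃
  have hdeg₂ : g₂.natDegree = 3 := glue_natDegree_neg_cubicPoly q₂ q₃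
  have hroot : ∀ e, (e = e₁ ∨ e = e₂ ∨ e = e₃) → cubic q₂ q₃ e = 0 := by
    rintro e (rfl | rfl | rfl) <;> rw [hf] <;> ring
  have hpos₁ : ∀ x ∈ Ioo e₃ e₂, 0 < aeval x g₁ := by
    intro x hx
    rw [hag₁, hf]
    have h1 : 0 < x - e₃ := by linarith [hx.1]
    have h2 : 0 < e₂ - x := by linarith [hx.2]
    have h3 : 0 < e₁ - x := by linarith [hx.2]
    have : 0 < 4 * (e₁ - x) * (e₂ - x) * (x - e₃) := by positivity
    linarith
  have hpos₂ : ∀ x ∈ Ioo e₂ e₁, 0 < aeval x g₂ := by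
    intro x hx
    rw [hag₂, hf]
    have h1 : 0 < x - e₃ := by linarith [hx.1]
    have h2 : 0 < x - e₂ := by linarith [hx.1]
    have h3 : 0 < e₁ - x := by linarith [hx.2]
    have : 0 < 4 * (e₁ - x) * (x - e₂) * (x - e₃) := by positivity
    linarith
  -- the exact-form property on the two ovals
  have hEx₁ : ∀ (Q : ℚ[X]) (s : KZ.IntegralRep 1), s.domain = {p | e₃ < p 0 ∧ p 0 < e₂} →
      EqOn s.integrand (fun p => (aeval (p 0) (derivative Q) * aeval (p 0) g₁
        + aeval (p 0) Q * aeval (p 0) (derivative g₁) / 2) / Real.sqrt (aeval (p 0) g₁)) s.domain →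
      KZ.of s ∈ KZ.relations := fun Q s hs hsi =>
    hexact g₁ Q e₃ e₂ h32 (by rw [hag₁]; exact hroot _ (Or.inr (Or.inr rfl)))
      (by rw [hag₁]; exact hroot _ (Or.inr (Or.inl rfl))) hpos₁ s hs hsi
  have hEx₂ : ∀ (Q : ℚ[X]) (s : KZ.IntegralRep 1), s.domain = {p | e₂ < p 0 ∧ p 0 < e₁} →
      EqOn s.integrand (fun p => (aeval (p 0) (derivative Q) * aeval (p 0) g₂
        + aeval (p 0) Q * aeval (p 0) (derivative g₂) / 2) / Real.sqrt (aeval (p 0) g₂)) s.domain →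
      KZ.of s ∈ KZ.relations := fun Q s hs hsi =>
    hexact g₂ Q e₂ e₁ h21 (by rw [hag₂, hroot _ (Or.inr (Or.inl rfl)), neg_zero])
      (by rw [hag₂, hroot _ (Or.inl rfl), neg_zero]) hpos₂ s hs hsi
  -- the four basis representations
  obtain ⟨b₀, b₁, b₂, b₃, ⟨hb₀d, hb₀i⟩, ⟨hb₁d, hb₁i⟩, ⟨hb₂d, hb₂i⟩, ⟨hb₃d, hb₃i⟩⟩ := exists_basis hrig
  -- their values
  have hv₀ : b₀.value = J₀ q₂ q₃ := by unfold KZ.IntegralRep.value J₀; rw [hb₀d, hb₀i]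
  have hv₁ : b₁.value = J₁ q₂ q₃ := by unfold KZ.IntegralRep.value J₁; rw [hb₁d, hb₁i]
  have hv₂ : b₂.value = K₀ q₂ q₃ := by unfold KZ.IntegralRep.value K₀; rw [hb₂d, hb₂i]
  have hv₃ : b₃.value = K₁ q₂ q₃ := by unfold KZ.IntegralRep.value K₁; rw [hb₃d, hb₃i]
  have hind : ∀ a₀ a₁ a₂ a₃ : ℚ, (a₀ : ℝ) * b₀.value + a₁ * b₁.value + a₂ * b₂.value + a₃ * b₃.value = 0 →
      a₀ = 0 ∧ a₁ = 0 ∧ a₂ = 0 ∧ a₃ = 0 := by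
    intro a₀ a₁ a₂ a₃ h
    rw [hv₀, hv₁, hv₂, hv₃] at h
    exact qRigidity_of_rigidity hrig a₀ a₁ a₂ a₃ h
  -- integer normal forms of the generators
  have hgen : ∀ s ∈ Gens q₂ q₃, ∃ (N : ℕ) (a₀ a₁ a₂ a₃ : ℤ), 0 < N ∧
      N • s - (a₀ • KZ.of b₀ + a₁ • KZ.of b₁ + a₂ • KZ.of b₂ + a₃ • KZ.of b₃) ∈ KZ.relations := by
    rintro s ((⟨r, m, hrd, hri, rfl⟩ | ⟨r, m, hrd, hri, rfl⟩) | ⟨r, hrd, hri, rfl⟩)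
    · -- first family: reduction on `σ = (e₃,e₂)` with `g = f`
      obtain ⟨N, a, b, hN, h⟩ := hred g₁ hdeg₁ e₃ e₂ hEx₁ b₀ b₁ r m
        (by rw [hb₀d, hσ₁]) (by rw [hb₀i]; intro p _; simp only [hag₁])
        (by rw [hb₁d, hσ₁]) (by rw [hb₁i]; intro p _; simp only [hag₁])
        (by rw [hrd, hσ₁]) (by rw [hrd]; intro p hp; rw [hri hp]; simp only [hag₁])
      refine ⟨N, a, b, 0, 0, hN, ?_⟩
      simpa using h
    · -- second family: reduction on `σ' = (e₂,e₁)` with `g = -f`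
      obtain ⟨N, a, b, hN, h⟩ := hred g₂ hdeg₂ e₂ e₁ hEx₂ b₂ b₃ r m
        (by rw [hb₂d, hσ₂]) (by rw [hb₂i]; intro p _; simp only [hag₂])
        (by rw [hb₃d, hσ₂]) (by rw [hb₃i]; intro p _; simp only [hag₂])
        (by rw [hrd, hσ₂]) (by rw [hrd]; intro p hp; rw [hri hp]; simp only [hag₂])
      refine ⟨N, 0, 0, a, b, hN, ?_⟩
      have e : N • KZ.of r - ((0 : ℤ) • KZ.of b₀ + (0 : ℤ) • KZ.of b₁ + a • KZ.of b₂ + b • KZ.of b₃)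
          = N • KZ.of r - (a • KZ.of b₂ + b • KZ.of b₃) := by
        simp only [zero_smul, zero_add]
      rw [e]; exact h
    · -- third family: the two-torsion move onto `b₀`
      have h := htors q₂ q₃ e₁ e₂ e₃ h32 h21 ha₁ ha₂ ha₃ hf r b₀ (by rw [hrd, hσ₃])
        (by rw [hrd]; exact hri) (by rw [hb₀d, hσ₁]) (by rw [hb₀i]; intro p _; rfl)
      refine ⟨1, 1, 0, 0, 0, one_pos, ?_⟩
      simpa using h
  -- closure induction
  intro c hc hc0
  have hnf : ∃ (N : ℕ) (a₀ a₁ a₂ a₃ : ℤ), 0 < N ∧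
      N • c - (a₀ • KZ.of b₀ + a₁ • KZ.of b₁ + a₂ • KZ.of b₂ + a₃ • KZ.of b₃) ∈ KZ.relations := by
    refine AddSubgroup.closure_induction (p := fun c _ => ∃ (N : ℕ) (a₀ a₁ a₂ a₃ : ℤ), 0 < N ∧
        N • c - (a₀ • KZ.of b₀ + a₁ • KZ.of b₁ + a₂ • KZ.of b₂ + a₃ • KZ.of b₃) ∈ KZ.relations)
      (fun s hs => hgen s hs) ?_ (fun x y _ _ hx hy => nf_add hx hy) (fun x _ hx => nf_neg hx) hc
    exact ⟨1, 0, 0, 0, 0, one_pos, by simp [KZ.relations.zero_mem]⟩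
  exact mem_relations_of_nf hind hc0 hnf

/-- **`RealEllipticSectorKernel` holds** (crux stmt-KontsevichZagierPeriods-10632 of route
`HermiteRigidity`): the composition applied to the four landed stubs of the line
`oval-hermite-engine`. [folklore] -/
theorem RealEllipticSectorKernel_proof : RealEllipticSectorKernel :=
  RealEllipticSectorKernel_of stub_roots stub_exactForm stub_twoTorsion stub_reduction

end Summit.KontsevichZagierPeriods.HermiteRigidity.RealEllipticSectorKernel

end
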